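import Mathlib
import Summits.CriticalPhenomena.PercolationContinuityZ3.Theorems.PercNearOneGluingAdditiveGluingSigmaRecursion
import Summits.CriticalPhenomena.PercolationContinuityZ3.Theorems.PercNearOneGluingAdditiveGluingSigmaLaw
import Summits.CriticalPhenomena.PercolationContinuityZ3.Theorems.PercNearOneGluingAdditiveGluingSigmaGeometry
import Summits.CriticalPhenomena.PercolationContinuityZ3.Theorems.PercNearOneGluingAdditiveGluingGluingLemma5
import Summits.CriticalPhenomena.PercolationContinuityZ3.Theorems.PercNearOneGluingAdditiveGluingGoodStep24Engine
import HarnessLib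

/-!
# `NoHeavyLowerTail` (stmt-CriticalPhenomena-4575) — Kozma–Nitzan's Theorem 4 at ARBITRARY observer depth
# under a uniformly dominated relay (sharp additive gluing, constant 1)

Support file (hull-port / coupling seat `prim-hp-1` gen 5; `--supports stmt-CriticalPhenomena-4575`).
No definitions, no named facts, no sorries.  Companion of `…NoHeavyLowerTailRelayCoreGluing.lean`
(the soft, witness-free form); this is the SHARP form with one designated relay.

Setting: `μ = prodBernoulli w` on the pairs of `Fin n`, relays `A`, target `b ∈ A`, a Steiner REGION
`R` disjoint from `A` that is closed under positive-weight pairs towards non-relays (every positive pair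
leaving `R` ends in `A`; e.g. `R` = the non-relay vertices of the component of `o` in `G ∖ A`), an observer
block `O ⊆ R`, and a relay `a⋆ ∈ A` that is UNIFORMLY DOMINATED from `O` inside `R`:
for every `U` with `O ⊆ U ⊆ R` and every relay `v` receiving a positive pair from `U`,
`P_{G−U}(a⋆ ↔ b) ≤ P_{G−U}(v ↔ b)` (`G − U` = all pairs meeting `U` closed, weights `kill_U w`).

* `uniformWitness_blockGluing` — then `μ_{glue O}(O ↔ A) − μ_{glue O}(O ↔ b) ≤ 1 − μ_{glue O}(a⋆ ↔ b)`.
  Proof: the σ-recursion engine `stub_sigmaRecursion` of the tree (Kozma–Nitzan arXiv:2401.12397,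
  proofs of Thms 4–5) with the SAME relay `a⋆` at every level: layers meeting `A` at `v` are KN Lemma 5
  (`stub_gluingLemma5`) in the world `kill_O w`, fed by domination at `U = O`; a non-empty Steiner layer
  `S` lies in `R` (closure), and the block `S` under `kill_O w` is again uniformly dominated inside `R`
  (`kill_{U'} (kill_O w) = kill_{O ∪ U'} w`), so it is the induction hypothesis (induction on the number
  of active non-relay vertices outside the block).
* `nearOneGluing_of_uniformWitness` — observer form: `o ∈ R`, `P(o ↔ A) − P(o ↔ b) ≤ P(a⋆ ↮ b)`;
  with `P(a⋆ ↔ b) ≥ 1 − t`: `P(o ↔ A) − t ≤ P(o ↔ b)` (`nearOneGluing_of_uniformWitness_le`).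
* `blockStarGluing` / KN Thm 4 is the case `R = O` (domination is then only asked at `U = O`, where the
  `kill_O`-minimiser supplies it): `nearOneGluing_of_isolated'` re-derives the one-layer theorem.

What it isolates (memo HULLPORT-COUPLING.md §43): between the exact Steiner-pocket decomposition of
`P(o ↔ A, o ↮ b)` and additive gluing with constant `1`, the ONLY non-re-summable step is that the
Lemma-5 comparison relay may change with the swallowed Steiner set `U`; uniform domination is precisely
'no switch', and then the recursion closes at every depth.
-/

namespace Summit.CriticalPhenomena.PercolationContinuityZ3.Theorems

open MeasureTheory Set
open Literature.Probability.LatticeModels (prodBernoulli)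
open Literature.Probability.Percolation (BondConfig openConn openGraph)

noncomputable section
open Classical

variable {n : ℕ}

/-- Killing twice is killing the union: `kill_{U'} (kill_O w) = kill_{O ∪ U'} w`. [folklore] -/
theorem uniformWitness_kill_kill (w : Sym2 (Fin n) → unitInterval) (O U' : Finset (Fin n)) :
    (fun e : Sym2 (Fin n) => if (∃ x ∈ e, x ∈ U') then (0 : unitInterval) else
        (if (∃ x ∈ e, x ∈ O) then 0 else w e)) =
      (fun e : Sym2 (Fin n) => if (∃ x ∈ e, x ∈ O ∪ U') then 0 else w e) := by
  funext e
  by_cases h1 : ∃ x ∈ e, x ∈ U'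
  · obtain ⟨x, hx, hxU⟩ := h1
    rw [if_pos ⟨x, hx, hxU⟩, if_pos ⟨x, hx, Finset.mem_union_right O hxU⟩]
  · rw [if_neg h1]
    by_cases h2 : ∃ x ∈ e, x ∈ O
    · obtain ⟨x, hx, hxO⟩ := h2
      rw [if_pos ⟨x, hx, hxO⟩, if_pos ⟨x, hx, Finset.mem_union_left U' hxO⟩]
    · rw [if_neg h2, if_neg]
      rintro ⟨x, hx, hxOU⟩
      rcases Finset.mem_union.1 hxOU with h | h
      · exact h2 ⟨x, hx, h⟩
      · exact h1 ⟨x, hx, h⟩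

/-- **Kozma–Nitzan's Theorem 4 at arbitrary depth, block form, under a uniformly dominated relay.**
Relays `A`, `b ∈ A`, `a⋆ ∈ A`, a region `R` disjoint from `A`.  For every `m`, every weight function `w`
under which `R` is closed (every positive pair from `R` to a non-relay stays in `R`) and every block
`O ⊆ R` with at most `m` active non-relay vertices outside `O`: if `a⋆` is uniformly dominated from `O`
inside `R` (`P_{kill_U w}(a⋆ ↔ b) ≤ P_{kill_U w}(v ↔ b)` for all `O ⊆ U ⊆ R` and all relays `v` receiving a
positive pair from `U`), then `μ_{glue O}(O ↔ A) − μ_{glue O}(O ↔ b) ≤ 1 − μ_{glue O}(a⋆ ↔ b)`.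
[cite: KozmaNitzan2024, Thm. 4 and Lemma 5 (pp. 12–14) — the one-layer case] -/
theorem uniformWitness_blockGluing (A : Finset (Fin n)) (b aStar : Fin n) (hbA : b ∈ A)
    (haA : aStar ∈ A) (R : Finset (Fin n)) (hRA : Disjoint R A) :
    ∀ (m : ℕ) (w : Sym2 (Fin n) → unitInterval) (O : Finset (Fin n)), O ⊆ R →
      (∀ x ∈ R, ∀ y : Fin n, y ∉ R → y ∉ A → w s(x, y) = 0) →
      (∀ U : Finset (Fin n), O ⊆ U → U ⊆ R → ∀ v ∈ A, (∃ x ∈ U, w s(x, v) ≠ 0) →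
        (prodBernoulli (fun e : Sym2 (Fin n) => if (∃ x ∈ e, x ∈ U) then 0 else w e)).real
            (openConn aStar b) ≤
          (prodBernoulli (fun e : Sym2 (Fin n) => if (∃ x ∈ e, x ∈ U) then 0 else w e)).real
            (openConn v b)) →
      (Finset.univ.filter fun x : Fin n =>
          x ∉ A ∧ x ∉ O ∧ ∃ y : Fin n, w s(x, y) ≠ 0).card ≤ m →
      (prodBernoulli (fun e : Sym2 (Fin n) =>
          if (∀ x ∈ e, x ∈ O) ∧ ¬ e.IsDiag then 1 else w e)).real
          (⋃ o ∈ O, ⋃ x ∈ A, openConn o x) -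
        (prodBernoulli (fun e : Sym2 (Fin n) =>
          if (∀ x ∈ e, x ∈ O) ∧ ¬ e.IsDiag then 1 else w e)).real
          (⋃ o ∈ O, openConn o b) ≤
        1 - (prodBernoulli (fun e : Sym2 (Fin n) =>
          if (∀ x ∈ e, x ∈ O) ∧ ¬ e.IsDiag then 1 else w e)).real (openConn aStar b) := by
  intro m
  induction m with
  | zero =>
    intro w O hOR hclosed hdom hcard
    exact step w O hOR hclosed hdom (fun S hS hSne hSA _ => by
      exfalso
      obtain ⟨x, hx⟩ := hSne
      obtain ⟨hxO, o, ho, hw⟩ := hS x hx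
      have hxA : x ∉ A := Finset.disjoint_left.1 hSA hx
      have hmem : x ∈ Finset.univ.filter fun x : Fin n =>
          x ∉ A ∧ x ∉ O ∧ ∃ y : Fin n, w s(x, y) ≠ 0 :=
        Finset.mem_filter.2 ⟨Finset.mem_univ _, hxA, hxO, o, by rwa [Sym2.eq_swap]⟩
      have := Finset.card_pos.2 ⟨x, hmem⟩
      omega)
  | succ m ih =>
    intro w O hOR hclosed hdom hcard
    exact step w O hOR hclosed hdom (fun S hS hSne hSA _ => by
      -- the Steiner layer `S` lies in `R` (closure) and the block `S` under `kill_O w` is again dominated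
      have hSR : S ⊆ R := by
        intro x hx
        obtain ⟨hxO, o, ho, hw⟩ := hS x hx
        by_contra hxR
        exact hw (hclosed o (hOR ho) x hxR (Finset.disjoint_left.1 hSA hx))
      refine ih (fun e : Sym2 (Fin n) => if (∃ x ∈ e, x ∈ O) then 0 else w e) S hSR ?_ ?_ ?_
      · -- closure of `R` under the killed weights
        intro x hx y hyR hyA
        show (if (∃ z ∈ s(x, y), z ∈ O) then (0 : unitInterval) else w s(x, y)) = 0
        rw [hclosed x hx y hyR hyA]
        split_ifs <;> rfl
      · -- uniform domination from `S`: `kill_{U'} (kill_O w) = kill_{O ∪ U'} w`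
        intro U' hSU' hU'R v hv hadj
        rw [uniformWitness_kill_kill w O U']
        refine hdom (O ∪ U') Finset.subset_union_left (Finset.union_subset hOR hU'R) v hv ?_
        obtain ⟨x, hxU', hwx⟩ := hadj
        have hO : ¬ (∃ z ∈ s(x, v), z ∈ O) := fun h => hwx (by
          show (if (∃ z ∈ s(x, v), z ∈ O) then (0 : unitInterval) else w s(x, v)) = 0
          rw [if_pos h])
        have hwx' : w s(x, v) ≠ 0 := by
          intro h0
          apply hwx
          show (if (∃ z ∈ s(x, v), z ∈ O) then (0 : unitInterval) else w s(x, v)) = 0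
          rw [if_neg hO, h0]
        exact ⟨x, Finset.mem_union_right O hxU', hwx'⟩
      · -- strictly fewer active non-relay vertices outside the block
        have hsub : (Finset.univ.filter fun x : Fin n =>
              x ∉ A ∧ x ∉ S ∧ ∃ y : Fin n,
                (if (∃ z ∈ s(x, y), z ∈ O) then (0 : unitInterval) else w s(x, y)) ≠ 0) ⊂
            (Finset.univ.filter fun x : Fin n => x ∉ A ∧ x ∉ O ∧ ∃ y : Fin n, w s(x, y) ≠ 0) := by
          rw [Finset.ssubset_iff_subset_ne]
          refine ⟨fun x hx => ?_, fun heq => ?_⟩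
          · obtain ⟨-, hxA, hxS, y, hy⟩ := Finset.mem_filter.1 hx
            have hO : ¬ (∃ z ∈ s(x, y), z ∈ O) := fun h => hy (by rw [if_pos h])
            rw [if_neg hO] at hy
            exact Finset.mem_filter.2 ⟨Finset.mem_univ _, hxA,
              fun hxO => hO ⟨x, Sym2.mem_mk_left x y, hxO⟩, y, hy⟩
          · obtain ⟨x, hx⟩ := hSne
            obtain ⟨hxO, o, ho, hw⟩ := hS x hx
            have hxA : x ∉ A := Finset.disjoint_left.1 hSA hx
            have hmem : x ∈ Finset.univ.filter fun x : Fin n =>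
                x ∉ A ∧ x ∉ O ∧ ∃ y : Fin n, w s(x, y) ≠ 0 :=
              Finset.mem_filter.2 ⟨Finset.mem_univ _, hxA, hxO, o, by rwa [Sym2.eq_swap]⟩
            rw [← heq] at hmem
            exact (Finset.mem_filter.1 hmem).2.2.1 hx
        have hlt := Finset.card_lt_card hsub
        omega)
  where
  /-- One application of the σ-recursion engine at the block `O` with the relay `a⋆`, given the
  designated inequality on non-empty positive Steiner layers. -/
  step (w : Sym2 (Fin n) → unitInterval) (O : Finset (Fin n)) (hOR : O ⊆ R)
      (hclosed : ∀ x ∈ R, ∀ y : Fin n, y ∉ R → y ∉ A → w s(x, y) = 0)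
      (hdom : ∀ U : Finset (Fin n), O ⊆ U → U ⊆ R → ∀ v ∈ A, (∃ x ∈ U, w s(x, v) ≠ 0) →
        (prodBernoulli (fun e : Sym2 (Fin n) => if (∃ x ∈ e, x ∈ U) then 0 else w e)).real
            (openConn aStar b) ≤
          (prodBernoulli (fun e : Sym2 (Fin n) => if (∃ x ∈ e, x ∈ U) then 0 else w e)).real
            (openConn v b))
      (hSteiner : ∀ S : Finset (Fin n), (∀ x ∈ S, x ∉ O ∧ ∃ o ∈ O, w s(o, x) ≠ 0) →
        S.Nonempty → Disjoint S A → b ∉ S →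
        (prodBernoulli (fun e : Sym2 (Fin n) =>
            if (∀ x ∈ e, x ∈ S) ∧ ¬ e.IsDiag then 1 else
              if (∃ x ∈ e, x ∈ O) then 0 else w e)).real (⋃ s ∈ S, ⋃ x ∈ A, openConn s x) -
          (prodBernoulli (fun e : Sym2 (Fin n) =>
            if (∀ x ∈ e, x ∈ S) ∧ ¬ e.IsDiag then 1 else
              if (∃ x ∈ e, x ∈ O) then 0 else w e)).real (⋃ s ∈ S, openConn s b) ≤
          1 - (prodBernoulli (fun e : Sym2 (Fin n) =>
            if (∀ x ∈ e, x ∈ S) ∧ ¬ e.IsDiag then 1 else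
              if (∃ x ∈ e, x ∈ O) then 0 else w e)).real (openConn aStar b)) :
      (prodBernoulli (fun e : Sym2 (Fin n) =>
          if (∀ x ∈ e, x ∈ O) ∧ ¬ e.IsDiag then 1 else w e)).real
          (⋃ o ∈ O, ⋃ x ∈ A, openConn o x) -
        (prodBernoulli (fun e : Sym2 (Fin n) =>
          if (∀ x ∈ e, x ∈ O) ∧ ¬ e.IsDiag then 1 else w e)).real
          (⋃ o ∈ O, openConn o b) ≤
        1 - (prodBernoulli (fun e : Sym2 (Fin n) =>
          if (∀ x ∈ e, x ∈ O) ∧ ¬ e.IsDiag then 1 else w e)).real (openConn aStar b) := by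
    have hOA : Disjoint O A := Finset.disjoint_of_subset_left hOR hRA
    have hbO : b ∉ O := fun h => Finset.disjoint_left.1 hOA h hbA
    exact stub_sigmaRecursion n w O A b aStar hOA hbO haA (stub_sigmaGeometry n O)
      (stub_sigmaLaw n w O)
      (fun S hS hSA hbS => by
        -- a positive layer meeting `A` at `v`: KN Lemma 5 in the world `kill_O w`, fed by domination at `U = O`
        obtain ⟨v, hv⟩ := hSA
        rw [Finset.mem_inter] at hv
        obtain ⟨-, o, ho, hw⟩ := hS v hv.1
        exact stub_gluingLemma5 n (fun e : Sym2 (Fin n) => if (∃ x ∈ e, x ∈ O) then 0 else w e)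
          S aStar v b hv.1 hbS (hdom O (Finset.Subset.refl O) hOR v hv.2 ⟨o, ho, hw⟩))
      hSteiner

/-- **Near-one gluing at arbitrary depth under a uniformly dominated relay** (observer form).  `o ∉ A`,
`b ∈ A`, `a⋆ ∈ A`, a region `R ∋ o` disjoint from `A` and closed under positive pairs towards non-relays, and
`a⋆` uniformly dominated from `o` inside `R` (`P_{G−U}(a⋆ ↔ b) ≤ P_{G−U}(v ↔ b)` whenever `o ∈ U ⊆ R` and
`v ∈ A` receives a positive pair from `U`).  Then `P(o ↔ A) − P(o ↔ b) ≤ P(a⋆ ↮ b)`, written as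
`1 − P(a⋆ ↔ b)`.  [cite: KozmaNitzan2024, Thm. 4 (pp. 12–14) — the case `R = {o}`] -/
theorem nearOneGluing_of_uniformWitness (n : ℕ) (w : Sym2 (Fin n) → unitInterval) (A R : Finset (Fin n))
    (o b aStar : Fin n) (hoR : o ∈ R) (hRA : Disjoint R A) (hbA : b ∈ A) (haA : aStar ∈ A)
    (hclosed : ∀ x ∈ R, ∀ y : Fin n, y ∉ R → y ∉ A → w s(x, y) = 0)
    (hdom : ∀ U : Finset (Fin n), o ∈ U → U ⊆ R → ∀ v ∈ A, (∃ x ∈ U, w s(x, v) ≠ 0) →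
      (prodBernoulli (fun e : Sym2 (Fin n) => if (∃ x ∈ e, x ∈ U) then 0 else w e)).real
          (openConn aStar b) ≤
        (prodBernoulli (fun e : Sym2 (Fin n) => if (∃ x ∈ e, x ∈ U) then 0 else w e)).real
          (openConn v b)) :
    (prodBernoulli w).real (⋃ a ∈ A, openConn o a) - (prodBernoulli w).real (openConn o b) ≤
      1 - (prodBernoulli w).real (openConn aStar b) := by
  have key := uniformWitness_blockGluing A b aStar hbA haA R hRA n w {o}
    (Finset.singleton_subset_iff.2 hoR) hclosed
    (fun U hoU hUR v hv hadj => hdom U (Finset.singleton_subset_iff.1 hoU) hUR v hv hadj)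
    ((Finset.card_le_univ _).trans (Fintype.card_fin n).le)
  rw [goodStep24_glue_singleton, Finset.set_biUnion_singleton, Finset.set_biUnion_singleton] at key
  exact key

/-- **Near-one gluing at arbitrary depth under a uniformly dominated, reliable relay**: under the hypotheses
of `nearOneGluing_of_uniformWitness` and `P(a⋆ ↔ b) ≥ 1 − t`, `P(o ↔ A) − t ≤ P(o ↔ b)`.
[cite: KozmaNitzan2024, Thm. 4 and Conj. 3 (pp. 12–15) — context] -/
theorem nearOneGluing_of_uniformWitness_le (n : ℕ) (w : Sym2 (Fin n) → unitInterval)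
    (A R : Finset (Fin n)) (o b aStar : Fin n) (t : ℝ) (hoR : o ∈ R) (hRA : Disjoint R A)
    (hbA : b ∈ A) (haA : aStar ∈ A)
    (hclosed : ∀ x ∈ R, ∀ y : Fin n, y ∉ R → y ∉ A → w s(x, y) = 0)
    (hdom : ∀ U : Finset (Fin n), o ∈ U → U ⊆ R → ∀ v ∈ A, (∃ x ∈ U, w s(x, v) ≠ 0) →
      (prodBernoulli (fun e : Sym2 (Fin n) => if (∃ x ∈ e, x ∈ U) then 0 else w e)).real
          (openConn aStar b) ≤
        (prodBernoulli (fun e : Sym2 (Fin n) => if (∃ x ∈ e, x ∈ U) then 0 else w e)).real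
          (openConn v b))
    (hrel : 1 - t ≤ (prodBernoulli w).real (openConn aStar b)) :
    (prodBernoulli w).real (⋃ a ∈ A, openConn o a) - t ≤ (prodBernoulli w).real (openConn o b) := by
  have key := nearOneGluing_of_uniformWitness n w A R o b aStar hoR hRA hbA haA hclosed hdom
  linarith

/-- **The one-layer case re-derived** (Kozma–Nitzan Thm 4, additive form): if `o ∉ A` sends positive pairs
only to relays, `b ∈ A` and `P(a ↔ b) ≥ 1 − t` for all `a ∈ A`, then `P(o ↔ A) − t ≤ P(o ↔ b)`:
take `R = {o}` and `a⋆` the minimiser of `P_{G−o}(· ↔ b)`.  [cite: KozmaNitzan2024, Thm. 4 (pp. 12–14)] -/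
theorem nearOneGluing_of_isolated' (n : ℕ) (w : Sym2 (Fin n) → unitInterval) (A : Finset (Fin n))
    (o b : Fin n) (t : ℝ) (hoA : o ∉ A) (hbA : b ∈ A)
    (hiso : ∀ y : Fin n, y ≠ o → y ∉ A → w s(o, y) = 0)
    (hrel : ∀ a ∈ A, 1 - t ≤ (prodBernoulli w).real (openConn a b)) :
    (prodBernoulli w).real (⋃ a ∈ A, openConn o a) - t ≤ (prodBernoulli w).real (openConn o b) := by
  obtain ⟨aStar, haA, hmin⟩ := Finset.exists_min_image A
    (fun x => (prodBernoulli (fun e : Sym2 (Fin n) =>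
      if (∃ z ∈ e, z ∈ ({o} : Finset (Fin n))) then 0 else w e)).real (openConn x b)) ⟨b, hbA⟩
  refine nearOneGluing_of_uniformWitness_le n w A {o} o b aStar t (Finset.mem_singleton_self o)
    (Finset.disjoint_singleton_left.2 hoA) hbA haA ?_ ?_ (hrel aStar haA)
  · intro x hx y hyR hyA
    rw [Finset.mem_singleton] at hx hyR
    subst hx
    exact hiso y hyR hyA
  · intro U hoU hUR v hv _
    have hU : U = {o} := Finset.Subset.antisymm hUR (Finset.singleton_subset_iff.2 hoU)
    subst hU
    exact hmin v hv

end

end Summit.CriticalPhenomena.PercolationContinuityZ3.Theorems
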